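import Literature.Computability.QuantumComplexity.HadamardGadgetIQP
import Literature.Computability.QuantumComplexity.PostBQPToPostIQP
import HarnessLib

/-!
# The Hadamard gadget, III: the post-selected IQP family of a post-selected Clifford+`T` family

Topic `Literature/Computability/QuantumComplexity`; sequel of `HadamardGadget.lean` and
`HadamardGadgetIQP.lean`, completing the *semantic* half of the discharge of the named fact
`PostBQPWith_subset_PostIQPWith` (`PostBQPToPostIQP.lean`; Bremner–Jozsa–Shepherd 2011, proof
of Thm. 1 with Fig. 1, arXiv:1005.1407 p. 7): for a family `F` of Clifford+`T` circuits
(input `|x⟩|0^m⟩`, output wire `0`, post-selection wire `1` read on `1`, the tree's `PostBQP`),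
the **gadget family** `HGadget.gadgetFamily F : PostIQPFamily` is defined — the IQP circuit
`H^{⊗M} D H^{⊗M}` of the gadget rewriting of the sandwich of `F.circ n`, its path variables
relabelled into the register normal form of `PostIQPFamily` (`HGadget.rho`: input wires first,
then the output wire `n` = the last variable of line `0`, then the post-selection block
`n+1, …, n+postLen n` holding the first variables of the ancilla lines, all gadget lines and the
last variable of line `1` (flipped by a `Z`, since `PostIQPFamily` post-selects on `0…0`), then
the last variables of the remaining lines) — and it is **proved** that on every input its
post-selection probability and its joint acceptance probability are exactly `2^{-D}` times those
of `F` (`postselectProbOn_gadgetFamily`, `jointAcceptProbOn_gadgetFamily`, `D = freshCount`),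
whence `HGadget.postDecides_gadgetFamily`: if `F` decides `L` with tolerance `ε` under
post-selection then so does `gadgetFamily F` ("an IQP circuit … with the same output conditional
probabilities as originally (now conditioned on the new extra post-selections too)").

What remains of `PostBQPWith_subset_PostIQPWith` is the **uniformity** of `gadgetFamily F` for
uniform `F` (BJS: the rewriting is a polynomial-time transformation of circuit descriptions),
isolated here as the hypothesis of `PostBQPWith_subset_PostIQPWith_of_gadgetUniform` and of the
per-family `mem_PostIQPWith_of_gadgetFamily`; it is the subject of the sequel files (a
polynomial-time string function computing the description of `gadgetFamily F` from that of `F`).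

## References

* M. J. Bremner, R. Jozsa, D. J. Shepherd, *Classical simulation of commuting quantum
  computations implies collapse of the polynomial hierarchy*, Proc. R. Soc. A 467 (2011)
  459–472, arXiv:1005.1407: Def. 3, §2.4, Thm. 1 (proof, Fig. 1), p. 7.
* S. Aaronson, *Quantum computing, postselection, and probabilistic polynomial-time*, Proc. R.
  Soc. A 461 (2005), Def. 1 (the tree's `PostBQP`: output wire `0`, post-selection wire `1`).
* M. A. Nielsen, I. L. Chuang, *Quantum Computation and Quantum Information*, CUP 2010, §2.2.5
  (Born rule).
-/

noncomputable section

namespace Literature.Computability.QuantumComplexity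

open _root_.Computability Complexity Cryptography Matrix
open Literature.Barriers.QuantumAdvantage
open Literature.Probability.RandomGraphs.LowDegree (sgn walsh sgn_true sgn_false)

namespace HGadget

variable {N : ℕ}

/-! ### Running a layer of Hadamard gates -/

/-- The rewriting step of a placed `hOn w` is the gadget on `w`. [folklore] -/
theorem step_hOn (s : St N) (w : Fin N) : step s (hOn w) = s.hadamard w := rfl

/-- A run of Hadamard gates on the wires `ws` allocates `|ws|` fresh variables. [folklore] -/
theorem k_run_map_hOn (s : St N) (ws : List (Fin N)) : (run s (ws.map hOn)).k = s.k + ws.length := by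
  induction ws generalizing s with
  | nil => rfl
  | cons w ws ih =>
    rw [List.map_cons, run_cons, step_hOn, ih]
    simp [St.hadamard]; omega

/-- A run of Hadamard gates does not move the current variables of the other wires. [folklore] -/
theorem cur_run_map_hOn_of_not_mem (s : St N) (ws : List (Fin N)) {a : Fin N} (ha : a ∉ ws) :
    (run s (ws.map hOn)).cur a = s.cur a := by
  induction ws generalizing s with
  | nil => rfl
  | cons w ws ih =>
    simp only [List.mem_cons, not_or] at ha
    rw [List.map_cons, run_cons, step_hOn, ih _ ha.2]
    simp [St.hadamard, Function.update_of_ne ha.1]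

/-- A run of Hadamard gates on distinct wires gives the `i`-th of them the fresh variable
`N + k + i`. [folklore] -/
theorem cur_run_map_hOn_get (s : St N) (ws : List (Fin N)) (hws : ws.Nodup) (i : Fin ws.length) :
    (run s (ws.map hOn)).cur (ws.get i) = N + s.k + i := by
  induction ws generalizing s with
  | nil => exact i.elim0
  | cons w ws ih =>
    have hw : w ∉ ws := (List.nodup_cons.1 hws).1
    have hws' : ws.Nodup := (List.nodup_cons.1 hws).2
    rw [List.map_cons, run_cons, step_hOn]
    refine Fin.cases ?_ (fun j => ?_) i
    · show (run (s.hadamard w) (ws.map hOn)).cur w = N + s.k + 0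
      rw [cur_run_map_hOn_of_not_mem _ _ hw]
      simp [St.hadamard]
    · show (run (s.hadamard w) (ws.map hOn)).cur (ws.get j) = N + s.k + (j + 1 : ℕ)
      rw [ih _ hws' j]
      simp [St.hadamard]; omega

/-- The Hadamard layer allocates `N` fresh variables. [folklore] -/
theorem k_run_hLayerGates (s : St N) : (run s (hLayerGates N)).k = s.k + N := by
  rw [hLayerGates, k_run_map_hOn, List.length_finRange]

/-- After the Hadamard layer, line `a` has the current variable `N + k + a`. [folklore] -/
theorem cur_run_hLayerGates (s : St N) (a : Fin N) : (run s (hLayerGates N)).cur a = N + s.k + a := by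
  have h := cur_run_map_hOn_get s (List.finRange N) (List.nodup_finRange N)
    (Fin.cast List.length_finRange.symm a)
  rw [List.get_finRange] at h
  simpa [hLayerGates] using h

/-! ### The gadget rewriting of the sandwich: counts and last variables -/

/-- The rewriting state after the first Hadamard layer and the gates of `C` (before the final
layer). [folklore] -/
def preState (C : QCircuit cliffordT N) : St N := run (St.init N) (hLayerGates N ++ C.gates)

/-- The number `K₁` of path variables allocated before the final Hadamard layer. [folklore] -/
def preCount (C : QCircuit cliffordT N) : ℕ := (preState C).k

/-- The final state is the final layer run from the pre-state. [folklore] -/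
theorem sfinal_eq (C : QCircuit cliffordT N) : sfinal C = run (preState C) (hLayerGates N) := by
  rw [sfinal, final, sandwich, run_append, preState]

/-- `D = K₁ + N`: the final layer allocates the `N` last variables. [folklore] -/
theorem freshCount_eq (C : QCircuit cliffordT N) : freshCount C = preCount C + N := by
  rw [freshCount, ← sfinal, sfinal_eq, k_run_hLayerGates, preCount]

/-- The last variable of line `a` is `N + K₁ + a`. [folklore] -/
theorem cur_sfinal (C : QCircuit cliffordT N) (a : Fin N) : (sfinal C).cur a = N + preCount C + a := by
  rw [sfinal_eq, cur_run_hLayerGates, preCount]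

/-! ### The relabelling into the register normal form -/

/-- **The relabelling** of the `M = N + D` path variables (`N = n + m`, `D = K₁ + N`,
`T = N + K₁` the native index of the last variable of line `0`): the input wires `v < n` stay,
the block `n ≤ v < T` (first variables of the ancilla lines and all gadget variables) moves up by
one, the last variable `T` of line `0` goes to the output position `n`, and the last variables
`T + a` of the lines `a ≥ 1` stay. [cite: BremnerJozsaShepherdPRSA2011, Thm. 1 (proof: SWAPs commuted to the end of the lines)] -/
def rho (n T : ℕ) (v : ℕ) : ℕ :=
  if v < n then v else if v < T then v + 1 else if v = T then n else v

/-- The inverse relabelling. [folklore] -/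
def rhoInv (n T : ℕ) (w : ℕ) : ℕ :=
  if w < n then w else if w = n then T else if w ≤ T then w - 1 else w

/-- `rhoInv` is a left inverse of `rho` (for `n ≤ T`). [folklore] -/
theorem rhoInv_rho {n T : ℕ} (hnT : n ≤ T) (v : ℕ) : rhoInv n T (rho n T v) = v := by
  unfold rho rhoInv
  split_ifs <;> omega

/-- `rho` is a left inverse of `rhoInv` (for `n ≤ T`). [folklore] -/
theorem rho_rhoInv {n T : ℕ} (hnT : n ≤ T) (w : ℕ) : rho n T (rhoInv n T w) = w := by
  unfold rho rhoInv
  split_ifs <;> omega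

/-- `rho` maps `[0, M)` to itself when `T < M`. [folklore] -/
theorem rho_lt {n T M : ℕ} (hTM : T < M) {v : ℕ} (hv : v < M) : rho n T v < M := by
  unfold rho; split_ifs <;> omega

/-- `rhoInv` maps `[0, M)` to itself when `T < M`. [folklore] -/
theorem rhoInv_lt {n T M : ℕ} (hTM : T < M) {w : ℕ} (hw : w < M) : rhoInv n T w < M := by
  unfold rhoInv; split_ifs <;> omega

/-- The relabelling as a permutation of `Fin M` (for `n ≤ T < M`). [folklore] -/
def rhoEquiv (n T M : ℕ) (hnT : n ≤ T) (hTM : T < M) : Fin M ≃ Fin M where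
  toFun v := ⟨rho n T v, rho_lt hTM v.isLt⟩
  invFun w := ⟨rhoInv n T w, rhoInv_lt hTM w.isLt⟩
  left_inv v := Fin.ext (rhoInv_rho hnT v)
  right_inv w := Fin.ext (rho_rhoInv hnT w)

/-- Values of the relabelling permutation. [folklore] -/
@[simp] theorem rhoEquiv_apply_val {n T M : ℕ} (hnT : n ≤ T) (hTM : T < M) (v : Fin M) :
    ((rhoEquiv n T M hnT hTM v : Fin M) : ℕ) = rho n T v := rfl

/-! ### The gadget circuit of a circuit on `n + m` wires, in register normal form -/

section Core

variable {n m : ℕ} (C : QCircuit cliffordT (n + m))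

/-- `T = N + K₁`, the native index of the last variable of line `0` (`N = n + m`). [folklore] -/
def TC : ℕ := n + m + preCount C

/-- **The relabelled gadget operations** of `C`: the gadget operations of the sandwich of `C`,
a `Z` on the native last variable `T + 1` of line `1` (the post-selection wire of the tree's
`PostBQP`, read on `1`; flipped because `PostIQPFamily` post-selects on `0…0`), all relabelled
by `rho n T`. [cite: BremnerJozsaShepherdPRSA2011, Thm. 1 (proof)] -/
def opsAt : List DOp :=
  ((sfinal C).ops ++ [DOp.Z (TC C + 1)]).map (DOp.map (rho n (TC C)))

/-- **The diagonal part of the gadget's IQP circuit** of `C`, on `n + (m + D)` wires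
(`D = freshCount C`). [cite: BremnerJozsaShepherdPRSA2011, Thm. 1 (proof)] -/
def diagAt : QCircuit iqpDiag (n + (m + freshCount C)) := realize _ (opsAt C)

/-- The size `m + K₁ + 1` of the post-selection block: after the relabelling it occupies the
positions `n+1, …, T+1` (`T = N + K₁`), holding the first variables of the `m` ancilla lines
(natively `n, …, N-1`), the `K₁` gadget variables allocated before the final Hadamard layer
(natively `N, …, T-1`) and the last variable `T+1` of line `1`.
[cite: BremnerJozsaShepherdPRSA2011, Thm. 1 (proof)] -/
def postLenAt : ℕ := m + preCount C + 1

variable {C}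

/-- In the valid range (`N ≥ 2`) the native index `T` of the last variable of line `0` is a
position of the register of `N + D` path variables. [folklore] -/
theorem TC_lt (hN : 1 < n + m) : TC C < n + m + freshCount C := by
  rw [freshCount_eq, TC]; omega

/-- The relabelling permutation of the gadget register of `C`, landing in the IQP register
`Fin (n + (m + D))`. [folklore] -/
def eAt (hN : 1 < n + m) : Fin (n + m + freshCount C) ≃ Fin (n + (m + freshCount C)) :=
  (rhoEquiv n (TC C) (n + m + freshCount C) (by rw [TC]; omega) (TC_lt hN)).trans
    (finCongr (Nat.add_assoc _ _ _))

/-- Values of the relabelling permutation. [folklore] -/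
theorem eAt_apply_val (hN : 1 < n + m) (v : Fin (n + m + freshCount C)) :
    ((eAt hN v : Fin (n + (m + freshCount C))) : ℕ) = rho n (TC C) v := rfl

/-- The relabelled operations are the gadget operations with the flip on line `1`. [folklore] -/
theorem opsAt_eq (hN : 1 < n + m) : opsAt C = gadgetOps C ⟨1, hN⟩ (rho n (TC C)) := by
  rw [opsAt, gadgetOps, cur_sfinal, TC]

/-- **The layout of the gadget circuit of `C`** in the IQP register: the native layout
transported along the relabelling. [folklore] -/
def layoutAt (hN : 1 < n + m) : Layout (n + m) (n + (m + freshCount C)) :=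
  (nativeLayout C).map (eAt hN)

/-- Positions of the first variables: input wires stay, ancilla lines move up by one. [folklore] -/
theorem layoutAt_fst_val (hN : 1 < n + m) (a : Fin (n + m)) :
    (((layoutAt (C := C) hN).fst a : Fin _) : ℕ) = if (a : ℕ) < n then (a : ℕ) else (a : ℕ) + 1 := by
  show rho n (TC C) a = _
  have ha : (a : ℕ) < TC C := by rw [TC]; omega
  unfold rho
  split_ifs <;> omega

/-- Positions of the last variables: line `0` at the output position `n`, line `a ≥ 1` at
`T + a`. [folklore] -/
theorem layoutAt_lst_val (hN : 1 < n + m) (a : Fin (n + m)) :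
    (((layoutAt (C := C) hN).lst a : Fin _) : ℕ) = if (a : ℕ) = 0 then n else TC C + a := by
  show rho n (TC C) ((sfinal C).cur a) = _
  rw [cur_sfinal, ← TC]
  have hT : n ≤ TC C := by rw [TC]; omega
  unfold rho
  split_ifs <;> omega

/-- **The amplitudes of the gadget circuit of `C`** (from `iqpAmplitude_gadget`): for an input
label `x` and an output label `y` of `C`,
`⟨y on lst| H^{⊗M} D H^{⊗M} |x on fst⟩ = 2^{-M} (√2)^D 2^N ⟨y[1 ↦ ¬y₁]|U_C|x⟩`.
[cite: BremnerJozsaShepherdPRSA2011, Thm. 1 (proof)] -/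
theorem iqpAmplitude_diagAt (hC : C.IsOracleFree) (hN : 1 < n + m) (x y : QReg (n + m)) :
    iqpAmplitude (diagAt C) (place (layoutAt hN).fst x) (place (layoutAt hN).lst y) =
      ((2 : ℂ) ^ (n + (m + freshCount C)))⁻¹ * ((Real.sqrt 2 : ℂ) ^ freshCount C *
        ((2 : ℂ) ^ (n + m) * C.toMatrix 0 (Function.update y ⟨1, hN⟩ (!y ⟨1, hN⟩)) x)) := by
  rw [diagAt, opsAt_eq hN]
  exact iqpAmplitude_gadget hC (eAt hN) (rho n (TC C)) (fun v h => rfl) ⟨1, hN⟩ x y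

/-- The padded input reads the input on the input wires. [folklore] -/
theorem padInput_apply_lt {k M : ℕ} (x : QReg k) (w : Fin (k + M)) (hw : (w : ℕ) < k) :
    padInput x M w = x ⟨w, hw⟩ := by
  change Fin.append x (fun _ => false) (Fin.castAdd M ⟨w, hw⟩) = _
  rw [Fin.append_left]

/-- The padded input reads `0` beyond the input wires. [folklore] -/
theorem padInput_apply_ge {k M : ℕ} (x : QReg k) (w : Fin (k + M)) (hw : k ≤ (w : ℕ)) :
    padInput x M w = false := by
  have : w = Fin.natAdd k ⟨(w : ℕ) - k, by omega⟩ := Fin.ext (by simp; omega)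
  rw [this, padInput, Fin.append_right]

/-- **The input label**: the IQP register's input `|x⟩|0^{m+D}⟩` is the input `|x⟩|0^m⟩` of `C`
placed on the first variables (ancilla lines start in `|0⟩`). [folklore] -/
theorem place_fst_padInput (hN : 1 < n + m) (xg : QReg n) :
    place (layoutAt (C := C) hN).fst (padInput xg m) = padInput xg (m + freshCount C) := by
  funext w
  by_cases h : ∃ a, (layoutAt (C := C) hN).fst a = w
  · obtain ⟨a, rfl⟩ := h
    rw [place_apply (layoutAt hN).fst_injective]
    have hv := layoutAt_fst_val (C := C) hN a
    by_cases ha : (a : ℕ) < n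
    · rw [if_pos ha] at hv
      have hlt : (((layoutAt (C := C) hN).fst a : Fin _) : ℕ) < n := by rw [hv]; exact ha
      rw [padInput_apply_lt xg ((layoutAt (C := C) hN).fst a) hlt, padInput_apply_lt xg a ha]
      congr 1
      exact Fin.ext hv.symm
    · rw [if_neg ha] at hv
      have hge : n ≤ (((layoutAt (C := C) hN).fst a : Fin _) : ℕ) := by rw [hv]; omega
      rw [padInput_apply_ge xg ((layoutAt (C := C) hN).fst a) hge, padInput_apply_ge xg a (by omega)]
  · rw [place_apply_of_forall_ne _ (fun a ha => h ⟨a, ha⟩)]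
    by_cases hw : (w : ℕ) < n
    · exfalso
      refine h ⟨⟨w, by omega⟩, Fin.ext ?_⟩
      rw [layoutAt_fst_val, if_pos hw]
    · rw [padInput_apply_ge xg w (by omega)]

/-- The last variables cover exactly the output position `n` and the top positions `> T`.
[folklore] -/
theorem exists_lst_eq_iff (hN : 1 < n + m) (w : Fin (n + (m + freshCount C))) :
    (∃ a, (layoutAt (C := C) hN).lst a = w) ↔ ((w : ℕ) = n ∨ TC C < (w : ℕ)) := by
  have hD := freshCount_eq C
  constructor
  · rintro ⟨a, rfl⟩
    rw [layoutAt_lst_val]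
    split_ifs with h
    · exact Or.inl rfl
    · right; omega
  · rintro (hw | hw)
    · refine ⟨⟨0, by omega⟩, Fin.ext ?_⟩
      rw [layoutAt_lst_val, if_pos rfl, hw]
    · have hlt : (w : ℕ) < n + (m + freshCount C) := w.isLt
      refine ⟨⟨(w : ℕ) - TC C, by rw [TC] at hw ⊢; omega⟩, Fin.ext ?_⟩
      rw [layoutAt_lst_val, if_neg (by simp; omega)]
      simp; omega

/-- Reading a position of `List.ofFn z`. [folklore] -/
theorem getD_ofFn {M : ℕ} (z : QReg M) {i : ℕ} (hi : i < M) : (List.ofFn z).getD i false = z ⟨i, hi⟩ := by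
  rw [List.getD_eq_getElem?_getD, List.getElem?_ofFn]
  simp [hi]

/-- **The post-selection event of the gadget family consists of the placed output labels of `C`
with post-selection bit `0`** (i.e. `1` before the flip): input wires, ancilla first variables
and all gadget variables read `0` exactly when the label vanishes off the last variables and at
the last variable of line `1`. [cite: BremnerJozsaShepherdPRSA2011, Thm. 1 (proof) with Def. 3] -/
theorem ofFn_mem_iqpPostselectStrings_iff (hN : 1 < n + m) (z : QReg (n + (m + freshCount C))) :
    List.ofFn z ∈ iqpPostselectStrings n (postLenAt C) ↔
      ∃ y : QReg (n + m), y ⟨1, hN⟩ = false ∧ z = place (layoutAt (C := C) hN).lst y := by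
  have hD := freshCount_eq C
  have hT : TC C = n + m + preCount C := rfl
  have hM : TC C + 1 < n + (m + freshCount C) := by omega
  simp only [iqpPostselectStrings, Set.mem_setOf_eq, postLenAt]
  constructor
  · rintro ⟨h1, h2⟩
    refine ⟨fun a => z ((layoutAt hN).lst a), ?_, funext fun w => ?_⟩
    · have := h2 (m + preCount C) (by omega)
      rw [getD_ofFn z (by omega)] at this
      convert this using 2
      exact Fin.ext (by rw [layoutAt_lst_val, if_neg (by simp)]; simp [hT]; omega)
    · by_cases hw : ∃ a, (layoutAt (C := C) hN).lst a = w
      · obtain ⟨a, rfl⟩ := hw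
        rw [place_apply (layoutAt hN).lst_injective]
      · rw [place_apply_of_forall_ne _ (fun a ha => hw ⟨a, ha⟩)]
        rw [exists_lst_eq_iff hN] at hw
        push Not at hw
        by_cases hwn : (w : ℕ) < n
        · have := h1 w hwn
          rwa [getD_ofFn z w.isLt] at this
        · have := h2 ((w : ℕ) - n - 1) (by omega)
          rw [getD_ofFn z (by omega)] at this
          convert this using 2
          exact Fin.ext (by simp; omega)
  · rintro ⟨y, hy, rfl⟩
    refine ⟨fun i hi => ?_, fun j hj => ?_⟩
    · rw [getD_ofFn _ (by omega), place_apply_of_forall_ne]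
      intro a ha
      have := congrArg Fin.val ha
      rw [layoutAt_lst_val] at this
      simp at this
      split_ifs at this <;> omega
    · rw [getD_ofFn _ (by omega)]
      by_cases hj' : j = m + preCount C
      · subst hj'
        have hl : (layoutAt (C := C) hN).lst ⟨1, hN⟩ = ⟨n + 1 + (m + preCount C), by omega⟩ :=
          Fin.ext (by rw [layoutAt_lst_val, if_neg (by simp)]; simp [hT]; omega)
        rw [← hl, place_apply (layoutAt hN).lst_injective, hy]
      · rw [place_apply_of_forall_ne]
        intro a ha
        have := congrArg Fin.val ha
        rw [layoutAt_lst_val] at this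
        simp at this
        split_ifs at this <;> omega

/-- The output position `n` of a placed label reads the output bit `y₀`. [folklore] -/
theorem ofFn_place_mem_iqpAcceptStrings_iff (hN : 1 < n + m) (y : QReg (n + m)) :
    List.ofFn (place (layoutAt (C := C) hN).lst y) ∈ iqpAcceptStrings n ↔ y ⟨0, by omega⟩ = true := by
  have hD := freshCount_eq C
  simp only [iqpAcceptStrings, Set.mem_setOf_eq]
  rw [getD_ofFn _ (by omega)]
  have hl : (layoutAt (C := C) hN).lst ⟨0, by omega⟩ = ⟨n, by omega⟩ :=
    Fin.ext (by rw [layoutAt_lst_val, if_pos rfl])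
  rw [← hl, place_apply (layoutAt hN).lst_injective]

/-- Placing along an injective map is injective. [folklore] -/
theorem place_injective {N M : ℕ} {f : Fin N → Fin M} (hf : Function.Injective f) :
    Function.Injective (place f) := fun y y' h => funext fun a => by
  rw [← place_apply hf y a, h, place_apply hf y' a]

/-- **Summing over the post-selection event is summing over the output labels of `C` with
post-selection bit `0`.** [folklore] -/
theorem sum_ite_mem_postselect (hN : 1 < n + m) (f : QReg (n + (m + freshCount C)) → ℝ) :
    open scoped Classical in
    (∑ z, if List.ofFn z ∈ iqpPostselectStrings n (postLenAt C) then f z else 0) =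
      ∑ y : QReg (n + m), if y ⟨1, hN⟩ = false then f (place (layoutAt (C := C) hN).lst y) else 0 := by
  classical
  rw [← Finset.sum_filter, ← Finset.sum_filter]
  have hset : (Finset.univ.filter fun z : QReg (n + (m + freshCount C)) =>
      List.ofFn z ∈ iqpPostselectStrings n (postLenAt C)) =
        (Finset.univ.filter fun y : QReg (n + m) => y ⟨1, hN⟩ = false).image
          (place (layoutAt (C := C) hN).lst) := by
    ext z
    simp only [Finset.mem_filter, Finset.mem_univ, true_and, Finset.mem_image,
      ofFn_mem_iqpPostselectStrings_iff hN]
    constructor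
    · rintro ⟨y, hy, rfl⟩; exact ⟨y, hy, rfl⟩
    · rintro ⟨y, hy, rfl⟩; exact ⟨y, hy, rfl⟩
  rw [hset, Finset.sum_image fun y _ y' _ h => place_injective (layoutAt hN).lst_injective h]

/-- `|2^{-M} (√2)^D 2^N c|² = 2^{-D} |c|²` for `M = N + D`. [folklore] -/
theorem norm_sq_amplitude_const {M N D : ℕ} (hM : M = N + D) (c : ℂ) :
    ‖((2 : ℂ) ^ M)⁻¹ * ((Real.sqrt 2 : ℂ) ^ D * ((2 : ℂ) ^ N * c))‖ ^ 2 = (1 / 2 : ℝ) ^ D * ‖c‖ ^ 2 := by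
  have hr : ((2 : ℂ) ^ M)⁻¹ * ((Real.sqrt 2 : ℂ) ^ D * ((2 : ℂ) ^ N * c)) =
      ((((2 : ℝ) ^ M)⁻¹ * (Real.sqrt 2 ^ D * 2 ^ N) : ℝ) : ℂ) * c := by
    push_cast; ring
  rw [hr, norm_mul, Complex.norm_real, Real.norm_eq_abs, abs_of_nonneg (by positivity), mul_pow]
  congr 1
  have hs : Real.sqrt 2 ^ 2 = 2 := Real.sq_sqrt (by norm_num)
  have h2D : (Real.sqrt 2 ^ D) ^ 2 = (2 : ℝ) ^ D := by rw [← pow_mul, mul_comm, pow_mul, hs]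
  have hN0 : (2 : ℝ) ^ N ≠ 0 := pow_ne_zero _ two_ne_zero
  have hD0 : (2 : ℝ) ^ D ≠ 0 := pow_ne_zero _ two_ne_zero
  rw [hM, pow_add, show ((2 : ℝ) ^ N * 2 ^ D)⁻¹ * (Real.sqrt 2 ^ D * 2 ^ N) =
    Real.sqrt 2 ^ D * ((2 : ℝ) ^ D)⁻¹ by field_simp, mul_pow, h2D, sq (((2 : ℝ) ^ D)⁻¹),
    ← mul_assoc, mul_inv_cancel₀ hD0, one_mul, one_div, inv_pow]

/-- **Output probabilities of the gadget circuit of `C` on the post-selection event**: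
`Pr[place lst y] = 2^{-D} |⟨y[1 ↦ ¬y₁]|U_C|x 0^m⟩|²`. [cite: BremnerJozsaShepherdPRSA2011, Thm. 1 (proof)] -/
theorem iqpProb_diagAt_place (hC : C.IsOracleFree) (hN : 1 < n + m) (xg : QReg n) (y : QReg (n + m)) :
    iqpProb (diagAt C) (padInput xg (m + freshCount C)) (place (layoutAt (C := C) hN).lst y) =
      (1 / 2 : ℝ) ^ freshCount C *
        ‖C.toMatrix 0 (Function.update y ⟨1, hN⟩ (!y ⟨1, hN⟩)) (padInput xg m)‖ ^ 2 := by
  rw [iqpProb, ← place_fst_padInput hN, iqpAmplitude_diagAt hC hN,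
    norm_sq_amplitude_const (Nat.add_assoc _ _ _).symm]

end Core

/-! ### The gadget family of a family of Clifford+`T` circuits -/

section Family

variable (F : QCircuitFamily cliffordT)

/-- **The gadget family** of a family of Clifford+`T` circuits: on inputs of length `n` its
diagonal part is the gadget circuit of `F.circ n` in register normal form (`diagAt`), with
`m + D` ancillas and a post-selection block of `m + K₁ + 1` wires. (BJS 2011, proof of Thm. 1:
the post-selected IQP circuit family of a post-selected circuit family.)
[cite: BremnerJozsaShepherdPRSA2011, Thm. 1 (proof)] -/
def gadgetFamily : PostIQPFamily where
  ancillas n := F.ancillas n + freshCount (F.circ n)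
  diag n := diagAt (F.circ n)
  postLen n := postLenAt (F.circ n)

/-- Born masses of an IQP kernel pushed to bit strings: the probability of an event `E` is the
sum of `|⟨z|H D H|z₀⟩|²` over the outcomes `z` read into `E` (no renormalisation).
(Nielsen–Chuang 2010, §2.2.5.) [cite: NielsenChuang2010, §2.2.5] -/
theorem toReal_bornPMF_iqp_map_ofFn {M : ℕ} (Dc : QCircuit iqpDiag M) (z₀ : QReg M)
    (E : Set (List Bool)) [DecidablePred (· ∈ E)] :
    (((bornPMF (iqpUnitary Dc *ᵥ basisState z₀)).map List.ofFn).toOuterMeasure E).toReal =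
      ∑ z : QReg M, if List.ofFn z ∈ E then iqpProb Dc z₀ z else 0 := by
  rw [PMF.toOuterMeasure_map_apply, PMF.toOuterMeasure_apply, tsum_fintype,
    ENNReal.toReal_sum (fun z _ => ?_)]
  · refine Finset.sum_congr rfl fun z _ => ?_
    simp only [Set.indicator, Set.mem_preimage]
    split_ifs
    · rw [bornPMF_iqp_apply, ENNReal.toReal_ofReal (iqpProb_nonneg _ _ _)]
    · rfl
  · simp only [Set.indicator]
    split_ifs
    · rw [bornPMF_iqp_apply]; exact ENNReal.ofReal_ne_top
    · exact ENNReal.zero_ne_top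

/-- The post-selection probability of a Clifford+`T` family as a sum over output labels with
post-selection bit `1`. (Aaronson 2005, Def. 1.) [cite: Aaronson2005, Def. 1] -/
theorem postselectProbOn_eq_sum (x : List Bool) (hN : 1 < x.length + F.ancillas x.length) :
    F.postselectProbOn 0 x = ∑ y : QReg (x.length + F.ancillas x.length),
      if y ⟨1, hN⟩ = true then ‖(F.circ x.length).toMatrix 0 y (padInput x.get (F.ancillas x.length))‖ ^ 2
        else 0 := by
  classical
  unfold QCircuitFamily.postselectProbOn QCircuit.postselectProb QCircuit.probEvent
  rw [Finset.sum_filter]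
  refine Finset.sum_congr rfl fun y _ => ?_
  have h : y ∈ QCircuit.postselectEvent (x.length + F.ancillas x.length) ↔ y ⟨1, hN⟩ = true := by
    simp only [QCircuit.postselectEvent, Set.mem_setOf_eq]
    exact ⟨fun ⟨_, h⟩ => h, fun h => ⟨hN, h⟩⟩
  simp only [h, QCircuit.runOn, mulVec_basisState]

/-- The joint acceptance probability of a Clifford+`T` family as a sum over output labels with
output bit `1` and post-selection bit `1`. (Aaronson 2005, Def. 1.) [cite: Aaronson2005, Def. 1] -/
theorem jointAcceptProbOn_eq_sum (x : List Bool) (hN : 1 < x.length + F.ancillas x.length) :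
    F.jointAcceptProbOn 0 x = ∑ y : QReg (x.length + F.ancillas x.length),
      if y ⟨0, by omega⟩ = true ∧ y ⟨1, hN⟩ = true then
        ‖(F.circ x.length).toMatrix 0 y (padInput x.get (F.ancillas x.length))‖ ^ 2 else 0 := by
  classical
  unfold QCircuitFamily.jointAcceptProbOn QCircuit.jointAcceptProb QCircuit.probEvent
  rw [Finset.sum_filter]
  refine Finset.sum_congr rfl fun y _ => ?_
  have h : y ∈ QCircuit.jointAcceptEvent (x.length + F.ancillas x.length) ↔
      y ⟨0, by omega⟩ = true ∧ y ⟨1, hN⟩ = true := by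
    simp only [QCircuit.jointAcceptEvent, Set.mem_setOf_eq]
    exact ⟨fun ⟨_, h⟩ => h, fun h => ⟨hN, h⟩⟩
  simp only [h, QCircuit.runOn, mulVec_basisState]

/-- Flipping the bit `i` reindexes a sum over the labels with `y_i = 0` into one over the
labels with `y_i = 1`. [folklore] -/
theorem sum_ite_flip {N : ℕ} (i : Fin N) (G : QReg N → ℝ) :
    (∑ y : QReg N, if y i = false then G (Function.update y i (!y i)) else 0) =
      ∑ y : QReg N, if y i = true then G y else 0 := by
  refine Fintype.sum_equiv (flipEquiv i) _ _ fun y => ?_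
  show (if y i = false then G (Function.update y i (!y i)) else 0) =
    if flipAt i y i = true then G (flipAt i y) else 0
  rw [flipAt_apply_self, flipAt]
  cases y i <;> simp

/-- The same with a further condition on another bit `j ≠ i`. [folklore] -/
theorem sum_ite_and_flip {N : ℕ} (i j : Fin N) (hji : j ≠ i) (G : QReg N → ℝ) :
    (∑ y : QReg N, if y j = true ∧ y i = false then G (Function.update y i (!y i)) else 0) =
      ∑ y : QReg N, if y j = true ∧ y i = true then G y else 0 := by
  refine Fintype.sum_equiv (flipEquiv i) _ _ fun y => ?_
  show (if y j = true ∧ y i = false then G (Function.update y i (!y i)) else 0) =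
    if flipAt i y j = true ∧ flipAt i y i = true then G (flipAt i y) else 0
  rw [flipAt_apply_self, flipAt_apply_of_ne i y hji, flipAt]
  cases y i <;> simp

/-- A positive post-selection probability forces at least two wires. [folklore] -/
theorem one_lt_of_postselectProbOn_pos {x : List Bool} (h : 0 < F.postselectProbOn 0 x) :
    1 < x.length + F.ancillas x.length := by
  by_contra hN
  apply lt_irrefl (0 : ℝ)
  have : F.postselectProbOn 0 x = 0 := by
    classical
    unfold QCircuitFamily.postselectProbOn QCircuit.postselectProb QCircuit.probEvent
    refine Finset.sum_eq_zero fun y hy => ?_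
    simp only [Finset.mem_filter, QCircuit.postselectEvent, Set.mem_setOf_eq] at hy
    exact absurd hy.2.1 hN
  rwa [this] at h

/-- **The post-selection probability of the gadget family is `2^{-D}` times that of `F`.**
[cite: BremnerJozsaShepherdPRSA2011, Thm. 1 (proof: "the same output conditional probabilities … now conditioned on the new extra post-selections too")] -/
theorem postselectProbOn_gadgetFamily (hF : F.IsOracleFree) (x : List Bool)
    (hN : 1 < x.length + F.ancillas x.length) :
    (gadgetFamily F).postselectProbOn x =
      (1 / 2 : ℝ) ^ freshCount (F.circ x.length) * F.postselectProbOn 0 x := by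
  classical
  unfold PostIQPFamily.postselectProbOn IQPFamily.kernel
  show (((bornPMF (iqpUnitary (diagAt (F.circ x.length)) *ᵥ basisState (padInput x.get
      (F.ancillas x.length + freshCount (F.circ x.length))))).map List.ofFn).toOuterMeasure
        (iqpPostselectStrings x.length (postLenAt (F.circ x.length)))).toReal = _
  rw [toReal_bornPMF_iqp_map_ofFn, sum_ite_mem_postselect hN]
  simp_rw [iqpProb_diagAt_place (hF x.length) hN]
  rw [postselectProbOn_eq_sum F x hN, Finset.mul_sum]
  simp_rw [mul_ite, mul_zero]
  exact sum_ite_flip ⟨1, hN⟩ (fun w => (1 / 2 : ℝ) ^ freshCount (F.circ x.length) *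
    ‖(F.circ x.length).toMatrix 0 w (padInput x.get (F.ancillas x.length))‖ ^ 2)

/-- **The joint acceptance probability of the gadget family is `2^{-D}` times that of `F`.**
[cite: BremnerJozsaShepherdPRSA2011, Thm. 1 (proof)] -/
theorem jointAcceptProbOn_gadgetFamily (hF : F.IsOracleFree) (x : List Bool)
    (hN : 1 < x.length + F.ancillas x.length) :
    (gadgetFamily F).jointAcceptProbOn x =
      (1 / 2 : ℝ) ^ freshCount (F.circ x.length) * F.jointAcceptProbOn 0 x := by
  classical
  unfold PostIQPFamily.jointAcceptProbOn IQPFamily.kernel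
  show (((bornPMF (iqpUnitary (diagAt (F.circ x.length)) *ᵥ basisState (padInput x.get
      (F.ancillas x.length + freshCount (F.circ x.length))))).map List.ofFn).toOuterMeasure
        (iqpAcceptStrings x.length ∩ iqpPostselectStrings x.length (postLenAt (F.circ x.length)))).toReal = _
  rw [toReal_bornPMF_iqp_map_ofFn]
  have hsplit : ∀ z : QReg (x.length + (F.ancillas x.length + freshCount (F.circ x.length))),
      (if List.ofFn z ∈ iqpAcceptStrings x.length ∩ iqpPostselectStrings x.length (postLenAt (F.circ x.length))
        then iqpProb (diagAt (F.circ x.length)) (padInput x.get (F.ancillas x.length + freshCount (F.circ x.length))) z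
        else 0) =
      (if List.ofFn z ∈ iqpPostselectStrings x.length (postLenAt (F.circ x.length)) then
        (if List.ofFn z ∈ iqpAcceptStrings x.length then
          iqpProb (diagAt (F.circ x.length)) (padInput x.get (F.ancillas x.length + freshCount (F.circ x.length))) z
          else 0) else 0) := by
    intro z
    by_cases h1 : List.ofFn z ∈ iqpPostselectStrings x.length (postLenAt (F.circ x.length)) <;>
      by_cases h2 : List.ofFn z ∈ iqpAcceptStrings x.length <;> simp [h1, h2]
  simp_rw [hsplit]
  rw [sum_ite_mem_postselect hN]
  simp_rw [ofFn_place_mem_iqpAcceptStrings_iff hN, iqpProb_diagAt_place (hF x.length) hN]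
  rw [jointAcceptProbOn_eq_sum F x hN, Finset.mul_sum]
  have hcomb : ∀ y : QReg (x.length + F.ancillas x.length),
      (if y ⟨1, hN⟩ = false then
        (if y ⟨0, by omega⟩ = true then (1 / 2 : ℝ) ^ freshCount (F.circ x.length) *
          ‖(F.circ x.length).toMatrix 0 (Function.update y ⟨1, hN⟩ (!y ⟨1, hN⟩))
            (padInput x.get (F.ancillas x.length))‖ ^ 2 else 0) else 0) =
      (if y ⟨0, by omega⟩ = true ∧ y ⟨1, hN⟩ = false then (1 / 2 : ℝ) ^ freshCount (F.circ x.length) *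
          ‖(F.circ x.length).toMatrix 0 (Function.update y ⟨1, hN⟩ (!y ⟨1, hN⟩))
            (padInput x.get (F.ancillas x.length))‖ ^ 2 else 0) := by
    intro y
    by_cases h1 : y ⟨1, hN⟩ = false <;> by_cases h0 : y ⟨0, by omega⟩ = true <;> simp [h0, h1]
  simp_rw [hcomb, mul_ite, mul_zero]
  have h01 : (⟨0, by omega⟩ : Fin (x.length + F.ancillas x.length)) ≠ ⟨1, hN⟩ := by simp
  exact sum_ite_and_flip ⟨1, hN⟩ ⟨0, by omega⟩ h01 (fun w => (1 / 2 : ℝ) ^ freshCount (F.circ x.length) *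
    ‖(F.circ x.length).toMatrix 0 w (padInput x.get (F.ancillas x.length))‖ ^ 2)

/-- **The gadget family decides what `F` decides, with the same tolerance.** If on every input
the post-selection wire of `F` reads `1` with positive probability and the conditional acceptance
probability is `≥ 1 - ε` on `x ∈ L` and `≤ ε` on `x ∉ L`, then `gadgetFamily F` post-decides `L`
with tolerance `ε` (`PostIQPFamily.PostDecides`). [cite: BremnerJozsaShepherdPRSA2011, Thm. 1 (proof)] -/
theorem postDecides_gadgetFamily (hF : F.IsOracleFree) {L : Language Bool} {ε : ℝ}
    (h : ∀ x, 0 < F.postselectProbOn 0 x ∧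
      (x ∈ L → 1 - ε ≤ F.condAcceptProbOn 0 x) ∧ (x ∉ L → F.condAcceptProbOn 0 x ≤ ε)) :
    (gadgetFamily F).PostDecides L ε := by
  intro x
  obtain ⟨hpos, hyes, hno⟩ := h x
  have hN := one_lt_of_postselectProbOn_pos F hpos
  have hc : 0 < (1 / 2 : ℝ) ^ freshCount (F.circ x.length) := by positivity
  have hcond : F.condAcceptProbOn 0 x = F.jointAcceptProbOn 0 x / F.postselectProbOn 0 x := rfl
  rw [postselectProbOn_gadgetFamily F hF x hN, jointAcceptProbOn_gadgetFamily F hF x hN]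
  refine ⟨mul_pos hc hpos, fun hx => ?_, fun hx => ?_⟩
  · have h1 := hyes hx
    rw [hcond, le_div_iff₀ hpos] at h1
    nlinarith
  · have h1 := hno hx
    rw [hcond, div_le_iff₀ hpos] at h1
    nlinarith

/-- **`PostBQPWith ε ⊆ PostIQPWith ε` for the languages of families whose gadget family is
uniform**: if `F` is an oracle-free family deciding `L` with tolerance `ε` under post-selection
and `gadgetFamily F` is uniform, then `L ∈ PostIQPWith ε`. What this leaves of the named fact
`PostBQPWith_subset_PostIQPWith` is the uniformity of `gadgetFamily F` for uniform `F`.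
[cite: BremnerJozsaShepherdPRSA2011, Thm. 1 (proof)] -/
theorem mem_PostIQPWith_of_gadgetFamily {ε : ℝ} {L : Language Bool} (hF : F.IsOracleFree)
    (hU : (gadgetFamily F).IsUniform)
    (h : ∀ x, 0 < F.postselectProbOn 0 x ∧
      (x ∈ L → 1 - ε ≤ F.condAcceptProbOn 0 x) ∧ (x ∉ L → F.condAcceptProbOn 0 x ≤ ε)) :
    L ∈ PostIQPWith ε :=
  ⟨gadgetFamily F, hU, postDecides_gadgetFamily F hF h⟩

end Family

/-- **The Hadamard gadget reduction, up to uniformity.** If the gadget family of every uniform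
oracle-free Clifford+`T` family is uniform (BJS 2011, proof of Thm. 1: the rewriting is a
polynomial-time transformation of circuit descriptions — the subject of the sequel files), then
`PostBQPWith ε ⊆ PostIQPWith ε` for every `ε`, i.e. the named fact
`PostBQPWith_subset_PostIQPWith`. [cite: BremnerJozsaShepherdPRSA2011, Thm. 1 (proof)] -/
theorem PostBQPWith_subset_PostIQPWith_of_gadgetUniform
    (hU : ∀ F : QCircuitFamily cliffordT, F.IsOracleFree → F.IsUniform → (gadgetFamily F).IsUniform) :
    PostBQPWith_subset_PostIQPWith := by
  rintro ε L ⟨F, hF, hFu, h⟩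
  exact mem_PostIQPWith_of_gadgetFamily F hF (hU F hF hFu) h

end HGadget

end Literature.Computability.QuantumComplexity
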